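import Mathlib.CategoryTheory.Action.Continuous
import Mathlib.CategoryTheory.Comma.Basic
import Mathlib.CategoryTheory.FintypeCat
import Mathlib.Topology.Category.FinTopCat
import Mathlib.Topology.Algebra.ContinuousMonoidHom
import Literature.AlgebraicGeometry.Frobenioids.Categories
import Literature.AlgebraicGeometry.Frobenioids.CategoriesFactorization
import Literature.AlgebraicGeometry.Frobenioids.Dissection
import HarnessLib

/-!
# Frobenioids II, Example 1.4: localizations of number fields (the categories `Q₀`, `P₀`, `E₀`)

Mochizuki, *The geometry of Frobenioids II: poly-Frobenioids*, Kyushu J. Math. **62** (2008)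
401–460, §1, Example 1.4 "Localizations of Number Fields" (i)–(iii), author's text pp. 12–13
[cite: MochizukiFrdII2008, Ex. 1.4 pp.12-13].

**Printed data (i).** `F̃/F` a Galois extension of a number field, `v` a (possibly archimedean)
valuation of `F`, `F_v` the completion, `F̃_v` the Galois extension of `F_v` determined by `F̃/F`,
`D_v ⊆ Gal(F̃/F)` the decomposition group of `v` (well-defined up to conjugation); `Q₀` = the full
subcategory of the Galois category of finite étale coverings of `Spec F` on the `Spec F' → Spec F`,
`F' ⊆ F̃` finite over `F`; `P₀` = the connected objects `Spec F' → Spec F_v`, `F' ⊆ F̃_v` finite over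
`F_v`; the restriction functor `ρ : Q₀ → P₀^⊥`; and `E₀` = the category of triples
`(P, Q, ι : P → ρ(Q))`, `ι` an isomorphism of `P` onto a connected component of `ρ(Q)`, with
morphisms the pairs `(P → P', Q → Q')` compatible with `ι, ι'`.

**Rendering (recorded for the referee; it is the author's own identification).**  On p. 62 of the
same paper Mochizuki writes "the category `P₀` of Example 1.4 may be identified with the category
`P_v := B(D_v)⁰`", `D_v = Gal(F̃_v/F_v) ⊆ Gal(F̃/F)`; likewise `Q₀ ≃ B(Gal(F̃/F))⁰` (finite transitive
continuous `Gal(F̃/F)`-sets `↔` finite subextensions of `F̃/F` up to isomorphism), `P₀^⊥ ≃ B(D_v)`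
(p. 12, bracket: "naturally equivalent to the full subcategory … whose connected components form
objects of `P₀`"), and `ρ` = restriction of the group action from `Gal(F̃/F)` to `D_v`.  We therefore
DEFINE everything for a topological group `G` (`= Gal(F̃/F)` with the Krull topology) and a subgroup
`D` (`= D_v`): `Q₀ := B(G)⁰`, `P₀ := B(D)⁰` (`B(-)` = `BCat`, `(-)⁰` = `ConnectedPart` of [FrdI] §0,
`Categories.lean`), `ρ := ` restriction along `D ↪ G` into `B(D)`, and `E₀` := the full subcategory
of the comma category `(P₀ ↪ B(D)) ↓ (Q₀ → B(D))` on the triples whose structure arrow `ι` is a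
monomorphism (for connected `P`, "isomorphism onto a connected component of `ρ(Q)`" and
"monomorphism into `ρ(Q)`" are the same thing in `B(D)`).  The dictionary `(F̃/F, v) ↦ (G, D_v)`
(Krull topology, decomposition group of an extension of `v` to `F̃`) is classical and is not
re-proved here; nothing below depends on `G` arising from a number field.

**Contents (one declaration per printed sub-item).** (i) the categories and functors `Q₀`, `P₀`,
`ρ`, `E₀`, `E₀ → P₀`, `E₀ → Q₀` (DEFINED); (ii) the printed claims, one named statement each
(explicit-model verifications, "one verifies immediately": typed, not yet discharged — R3a genre),
with a CAVEAT on the `Aut`-bijection (see its docstring); (iii) the application paragraph as one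
named statement over an abstract functor `P₀ → D₀`.  Proposition 1.5 itself is typed and largely
proved, generically, in `NumberFieldLocalizations.lean` / `NumberFieldLocalizationsAut.lean`.
Nothing here bears on [IUTchIII].
-/

namespace Literature.AlgebraicGeometry.Frobenioids

open CategoryTheory
open scoped FintypeCatDiscrete

universe v' u' u

namespace NFLocCat

variable (G : Type u) [Group G] [TopologicalSpace G] (D : Subgroup G)

/-! ### Example 1.4 (i): the categories `Q₀`, `P₀`, the functor `ρ`, the category `E₀` -/

/-- `Q₀` (FrdII Ex. 1.4 (i), p. 12): the finite étale coverings `Spec F' → Spec F` with `F' ⊆ F̃`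
finite over `F`, rendered (p. 62) as the connected objects `B(G)⁰` of `B(G)`, `G = Gal(F̃/F)`.
[cite: MochizukiFrdII2008, Ex. 1.4 (i) p.12] -/
abbrev QCat : Type (u + 1) := ConnectedPart (BCat G)

/-- `P₀` (FrdII Ex. 1.4 (i), p. 12): the connected finite étale coverings `Spec F' → Spec F_v` with
`F' ⊆ F̃_v` finite over `F_v`, "identified with `B(D_v)⁰`" (p. 62). [cite: MochizukiFrdII2008, Ex. 1.4 (i) p.12] -/
abbrev PCat : Type (u + 1) := ConnectedPart (BCat D)

/-- The inclusion `D_v ↪ Gal(F̃/F)` as a continuous homomorphism. [cite: MochizukiFrdII2008, Ex. 1.4 (i) p.12] -/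
def incl : D →ₜ* G := ⟨D.subtype, continuous_subtype_val⟩

/-- Restriction of the Galois action from `G = Gal(F̃/F)` to `D = D_v`: `B(G) → B(D)` — "restriction
to `Spec F_v`", `Spec F' ↦ Spec(F' ⊗_F F_v)` (FrdII Ex. 1.4 (i), p. 12).
[cite: MochizukiFrdII2008, Ex. 1.4 (i) p.12] -/
abbrev res : BCat G ⥤ BCat D := ContAction.res FintypeCat.{u} (incl G D)

/-- `ρ : Q₀ → P₀^⊥` (FrdII Ex. 1.4 (i), p. 12), with `P₀^⊥` rendered as `B(D)` ("naturally equivalent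
to the full subcategory of the Galois category of finite étale coverings of `Spec F_v` consisting of
objects whose connected components form objects of `P₀`", p. 12). [cite: MochizukiFrdII2008, Ex. 1.4 (i) p.12] -/
def rho : QCat G ⥤ BCat D := (connectedObjects (BCat G)).ι ⋙ res G D

/-- The ambient comma category of triples `(P, Q, ι : P → ρ(Q))`, `P ∈ Ob(P₀)`, `Q ∈ Ob(Q₀)`, `ι` any
arrow of `B(D)`, with morphisms the compatible pairs (FrdII Ex. 1.4 (i), p. 12).
[cite: MochizukiFrdII2008, Ex. 1.4 (i) p.12] -/
abbrev Triples : Type (u + 1) := Comma (connectedObjects (BCat D)).ι (rho G D)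

/-- The defining condition of `E₀` inside the triples: `ι` is "an isomorphism of `P` onto a connected
component of `ρ(Q)`", i.e. (for connected `P`, in `B(D)`) a monomorphism `P → ρ(Q)`
(FrdII Ex. 1.4 (i), p. 12). [cite: MochizukiFrdII2008, Ex. 1.4 (i) p.12] -/
def isLocalization : ObjectProperty (Triples G D) := fun T => Mono T.hom

/-- `E₀` (FrdII Ex. 1.4 (i), p. 12): "connected finite étale coverings of `Spec F_v` equipped with a
localization morphism to a connected finite étale covering of `Spec F` determined by a finite
subextension of `F̃/F`" — the full subcategory of `Triples` cut out by `isLocalization`.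
[cite: MochizukiFrdII2008, Ex. 1.4 (i) p.12] -/
abbrev ECat : Type (u + 1) := (isLocalization G D).FullSubcategory

/-- The natural functor `E₀ → P₀`, `(P, Q, ι) ↦ P` (FrdII Ex. 1.4 (ii), p. 13).
[cite: MochizukiFrdII2008, Ex. 1.4 (ii) p.13] -/
def toP₀ : ECat G D ⥤ PCat G D := (isLocalization G D).ι ⋙ Comma.fst _ _

/-- The natural functor `E₀ → Q₀`, `(P, Q, ι) ↦ Q` (FrdII Ex. 1.4 (ii), p. 13).
[cite: MochizukiFrdII2008, Ex. 1.4 (ii) p.13] -/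
def toQ₀ : ECat G D ⥤ QCat G := (isLocalization G D).ι ⋙ Comma.snd _ _

variable {G D} in
/-- The structure arrow `ι : P → ρ(Q)` of an object of `E₀` is a monomorphism (by definition).
[cite: MochizukiFrdII2008, Ex. 1.4 (i) p.12] -/
theorem mono_hom (T : ECat G D) : Mono T.obj.hom := T.property

variable {G D} in
/-- Morphisms of `E₀` are compatible with the structure arrows: `ι' ∘ (P → P') = ρ(Q → Q') ∘ ι`.
[cite: MochizukiFrdII2008, Ex. 1.4 (i) p.12] -/
theorem hom_w {T T' : ECat G D} (f : T ⟶ T') :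
    (connectedObjects (BCat D)).ι.map f.hom.left ≫ T'.obj.hom = T.obj.hom ≫ (rho G D).map f.hom.right :=
  f.hom.w

/-! ### Example 1.4 (ii): the printed properties (named statements; explicit-model genre) -/

/-- FrdII Ex. 1.4 (ii), p. 13: "the category `E₀` is connected". [cite: MochizukiFrdII2008, Ex. 1.4 (ii) p.13] -/
def EConnected : Prop := IsConnected (ECat G D)

/-- FrdII Ex. 1.4 (ii), p. 13: "`E₀` is … totally epimorphic". [cite: MochizukiFrdII2008, Ex. 1.4 (ii) p.13] -/
def ETotallyEpimorphic : Prop := IsTotallyEpimorphic (ECat G D)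

/-- FrdII Ex. 1.4 (ii), p. 13: "`E₀ → P₀` is faithful". [cite: MochizukiFrdII2008, Ex. 1.4 (ii) p.13] -/
def ToP₀Faithful : Prop := (toP₀ G D).Faithful

/-- FrdII Ex. 1.4 (ii), p. 13: "`E₀ → P₀` is … arrow-wise essentially surjective [cf. §0]".
[cite: MochizukiFrdII2008, Ex. 1.4 (ii) p.13] -/
def ToP₀ArrowwiseEssSurj : Prop := IsArrowwiseEssSurj (toP₀ G D)

/-- FrdII Ex. 1.4 (ii), p. 13, AS PRINTED (named statement, not asserted): "if `E₀ ∈ Ob(E₀)` projects to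
`P₀ ∈ Ob(P₀)`, then `E₀ → P₀` induces a bijection `Aut_{E₀}(E₀) ⥲ Aut_{P₀}(P₀)`".  CAVEAT (recorded, no
side taken): for `(G, D) ≅ (S₃, A₃)` — realised by `F̃ = ℚ(∛2, ζ₃)/ℚ`, `v = 7` — and the object
`(P, Q, ι)` with `Q ↔ ℚ(∛2)` (so `Aut_{Q₀}(Q) = 1`) and `P ↔ ℚ₇(∛2)` (`Aut_{P₀}(P) ≅ ℤ/3`), the map is
`1 → ℤ/3`, not surjective; injectivity holds whenever `E₀ → P₀` is faithful.
[cite: MochizukiFrdII2008, Ex. 1.4 (ii) p.13] -/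
def AutBijective : Prop := ∀ T : ECat G D, Function.Bijective fun a : Aut T => (toP₀ G D).mapIso a

/-- FrdII Ex. 1.4 (ii), p. 13: the FSM-morphisms of `E₀` that are not isomorphisms are exactly those
arising from finite extensions `F₁ ⊆ F₂ ⊆ F̃` with `v₂ | v₁ | v` and trivial local extension
`(F₂)_{v₂} = (F₁)_{v₁}` — in the `B(G)`-rendering: the morphisms `(P, Q₂, ι₂) → (P', Q₁, ι₁)` whose
`P`-component is an isomorphism (same local object) [and whose `Q`-component is not].  Typed as the
equivalence "FSM and not an isomorphism `↔` `P`-component invertible and not an isomorphism".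
[cite: MochizukiFrdII2008, Ex. 1.4 (ii) p.13] -/
def FSMDescription : Prop :=
  ∀ {T T' : ECat G D} (f : T ⟶ T'),
    (IsFSM f ∧ ¬ IsIso f) ↔ (IsIso ((toP₀ G D).map f) ∧ ¬ IsIso f)

/-- FrdII Ex. 1.4 (ii), p. 13: "Thus, the category `E₀` is not [in general] of FSM-type" — typed as: if
some object of `Q₀` admits a non-invertible arrow `Q₂ → Q₁` of `Q₀` restricting to an isomorphism on a
`D`-component (a proper subextension with a trivial local extension), then `E₀` is not of FSM-type.
[cite: MochizukiFrdII2008, Ex. 1.4 (ii) p.13] -/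
def NotFSMType : Prop :=
  (∃ (T T' : ECat G D) (f : T ⟶ T'), IsIso ((toP₀ G D).map f) ∧ ¬ IsIso f) → ¬ IsOfFSMType (ECat G D)

/-- FrdII Ex. 1.4 (ii), p. 13: "one verifies immediately that `E₀` is of FSMFF-type".
[cite: MochizukiFrdII2008, Ex. 1.4 (ii) p.13] -/
def EFSMFF : Prop := IsOfFSMFFType (ECat G D)

/-- Also recorded (used by Prop. 1.5 (iii), (viii)): "`P₀`, `E₀` totally epimorphic" — the `P₀` half,
i.e. `B(D)⁰` is totally epimorphic ([FrdI] §0; FrdII p. 14 "the total epimorphicity of `E₀` and `P₀`").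
[cite: MochizukiFrdII2008, Prop. 1.5 (iii) p.14] -/
def PTotallyEpimorphic : Prop := IsTotallyEpimorphic (PCat G D)

/-! ### Example 1.4 (iii): the application to `p`-adic Frobenioids (named statement) -/

/-- FrdII Ex. 1.4 (iii), p. 13, for `v` nonarchimedean over `p`, with the "evident natural functor
`P₀ → D₀`" (`D₀` = connected finite étale coverings of `Spec ℚ_p`, Ex. 1.1) taken as a datum `toD₀`:
for a connected, totally epimorphic category `P` with a functor `P → P₀`, the fiber product
`E := P ×_{P₀} E₀` is connected and totally epimorphic and carries `E → P₀ → D₀` ("cf. Prop. 1.5 (ii),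
(iii)"); if `P` is of FSM-type then `E` is of FSMFF-type ("cf. Prop. 1.5 (viii)"); if `P` is slim then so
is `E` ("cf. Prop. 1.5 (iv)"; the Frobenius-slim clause waits for [FrdI] Def. 3.1 (i), TODO-merge
abc-iut-L1-t3); if `P` is of strongly indissectible type then so is `E` ("cf. Prop. 1.5 (vii)").
Typed as one named statement (its parts are instances of Prop. 1.5, files `NumberFieldLocalizations*`).
[cite: MochizukiFrdII2008, Ex. 1.4 (iii) p.13] -/
def ApplicationToPadicFrobenioids : Prop :=
  ∀ {D₀ : Type u'} [Category.{v'} D₀] (_toD₀ : PCat G D ⥤ D₀)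
    {P : Type u'} [Category.{v'} P] (Φ : P ⥤ PCat G D),
    IsConnected P → IsTotallyEpimorphic P →
      IsConnected (CFP Φ (toP₀ G D)) ∧ IsTotallyEpimorphic (CFP Φ (toP₀ G D)) ∧
      (IsOfFSMType P → IsOfFSMFFType (CFP Φ (toP₀ G D))) ∧
      (IsSlim P → IsSlim (CFP Φ (toP₀ G D))) ∧
      (IsOfStronglyIndissectibleType P → IsOfStronglyIndissectibleType (CFP Φ (toP₀ G D)))

/-- REPAIRED, antecedent-carrying form of `ApplicationToPadicFrobenioids` (RULING P1 spirit; additive):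
FrdII Ex. 1.4 (iii) for `G` PROFINITE (compact, totally disconnected topological group — the printed
`Gal(F̃/F)`), with the strongly-indissectible clause ("cf. Prop. 1.5 (vii)") guarded by the
non-degeneracy hypothesis of the repaired Prop. 1.5 (vii) (`NFLoc.dissectible_iff_fst`: an object of `E`
is non-initial iff its projection is).  RECORDED (neutral): AS TYPED, `ApplicationToPadicFrobenioids G D`
fails (a) for non-profinite `G` (connectedness: `E₀ → P₀` need not be essentially surjective) and (b) in
its fifth conjunct even at the arithmetic instance `(G, D) = (Gal(ℚ(√2,√3)/ℚ), D_{23}) ≅ (ℤ/2 × ℤ/2, 1)`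
(`P₀` has only initial objects, while `E₀ ≃` the subgroup poset of `ℤ/2 × ℤ/2` has a strongly
dissectible object) — the degenerate case of Prop. 1.5 (vii).  The first four conjuncts of this repaired
form are discharged by seat abc-iut-L1-d4's `application_of_profinite`, the fifth by its
`isOfStronglyIndissectibleType_of_fst`. [cite: MochizukiFrdII2008, Ex. 1.4 (iii) p.13] -/
def ApplicationToPadicFrobenioidsRepaired : Prop :=
  IsTopologicalGroup G → CompactSpace G → TotallyDisconnectedSpace G →
    ∀ {P : Type u'} [Category.{v'} P] (Φ : P ⥤ PCat G D),
      IsConnected P → IsTotallyEpimorphic P →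
        (IsConnected (CFP Φ (toP₀ G D)) ∧ IsTotallyEpimorphic (CFP Φ (toP₀ G D)) ∧
          (IsOfFSMType P → IsOfFSMFFType (CFP Φ (toP₀ G D))) ∧
          (IsSlim P → IsSlim (CFP Φ (toP₀ G D)))) ∧
        ((∀ Y : CFP Φ (toP₀ G D), IsNonemptyObj Y ↔ IsNonemptyObj Y.fst) →
          IsOfStronglyIndissectibleType P → IsOfStronglyIndissectibleType (CFP Φ (toP₀ G D)))

end NFLocCat

end Literature.AlgebraicGeometry.Frobenioids
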